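import Literature.Analysis.FluidPDE.PassiveScalarExistenceProofs
import Literature.Analysis.FluidPDE.PassiveScalarForcedClass
import Literature.Analysis.FunctionSpaces.SpaceTimeWeakCompactness
import HarnessLib

/-!
# Route LimitingAbsorption — `RelaxationBoundsInventory`: packaging a weak limit as a sourced
  weak solution (stub `stub_forcedOfWeakIdentity` of line `Sketch`, crux stmt-AnomalousDissipation-2940)

Support lemma for item stmt-AnomalousDissipation-2940 (`RelaxationBoundsInventory`, route
`route-AnomalousDissipation-LimitingAbsorption`). In the line `Sketch` the Riemann–Duhamel
superpositions `W_N` of homogeneous passive scalars released along a grid of phases converge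
weak-* in `L^∞(0,T; L²(T^d))` to a field `W`; the lead shows that `W` has a measurable space–time
lift, obeys a slice bound `∫ |W(t)|² ≤ B` for a.e. `t ∈ (0,T)`, and satisfies the SOURCED weak
identity `∫₀ᵀ∫ W (∂ₜψ + u·∇ψ + κΔψ) = -∫₀ᵀ∫ h ψ` (steady source `h ∈ L²(T^d)`, zero datum) for every
space–time test function `ψ` on `[0,T)`. This file (stub `stub_forcedOfWeakIdentity`) packages such
a `W` as a member of the sourced weak class `Torus.IsWeakScalarTransportForcedOn T κ u (fun _ => h) 0 W`
of `FluidPDE/PassiveScalarForced` (DiPerna–Lions 1989, §II.1 with a right-hand side; DEIJ 2022,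
(1.1) with forcing).

## Proof idea

The weak identity is the hypothesis (the datum term `∫ 0 · ψ(0)` vanishes); the remaining
conjuncts of the class are bookkeeping, exactly as in the tree's template
`Torus.IsWeakScalarTransportOn.of_tendsto` (`FluidPDE/PassiveScalarExistenceProofs`):
* `u ∈ L¹(0,T; L²)` and `u W ∈ L¹((0,T) × T^d)` from the essential bound `‖u‖ ≤ C` a.e.
  (`Torus.ae_ae_norm_le_of_memLp_top_stLift`), the slice bound of `W`, `‖W(t)‖₁ ≤ ‖W(t)‖₂` on the
  probability space `T^d`, and `|(0,T)| < ∞`;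
* the steady source `(t, x) ↦ h x` is measurable on `(0,T) × T^d` (composition with the second
  projection) and `∫₀ᵀ ∫ |h| ≤ |(0,T)| · ‖h‖₂ < ∞`.
No positivity of `T` is needed (for `T ≤ 0` all integrals are over a null set).

## References

* R. J. DiPerna, P.-L. Lions, *Ordinary differential equations, transport theory and Sobolev
  spaces*, Invent. Math. 98 (1989), 511–547, §II.1, Prop. II.1. [`DiPernaLions1989`]
* T. D. Drivas, T. M. Elgindi, G. Iyer, I.-J. Jeong, *Anomalous dissipation in passive scalar
  transport*, Arch. Ration. Mech. Anal. 243 (2022), (1.1)–(1.3). [`DEIJ2022`]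
-/

noncomputable section

open MeasureTheory Set Filter Function TopologicalSpace Topology
open scoped ENNReal NNReal InnerProductSpace BigOperators

namespace Summit.AnomalousDissipation.AnomalousDissipation.Theorems.RelaxationBoundsInventory.ForcedOfWeakIdentity

set_option linter.dupNamespace false

open Literature.Analysis Literature.Analysis.FluidPDE Literature.Analysis.FluidPDE.Torus

variable {d : Type*} [Fintype d]

/-! ## Bookkeeping of a bounded drift -/

/-- **`u ∈ L^∞((0,T) × T^d)` is in `L¹(0,T; L²(T^d))`**: `∫₀ᵀ (∫ ‖u(t)‖²)^{1/2} dt < ∞`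
(the essential bound `‖u‖ ≤ C` a.e. gives `∫ ‖u(t)‖² ≤ C²` for a.e. `t`, and `|(0,T)| < ∞`;
template: `Torus.IsWeakScalarTransportOn.of_tendsto`). [folklore] -/
theorem lintegral_velocity_lt_top {T : ℝ} {u : ℝ → UnitAddTorus d → EuclideanSpace ℝ d}
    (hu : MemLp (FunctionSpaces.Torus.stLift u) ⊤ (volume.restrict (Ioo 0 T ×ˢ univ))) :
    ∫⁻ t in Ioo 0 T, (∫⁻ x, ‖u t x‖ₑ ^ 2) ^ (1 / 2 : ℝ) < ∞ := by
  -- adapted from `Literature.Analysis.FluidPDE.Torus.IsWeakScalarTransportOn.of_tendsto`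
  obtain ⟨Cu', -, hCu'⟩ := ae_ae_norm_le_of_memLp_top_stLift hu
  have hu2 : ∀ᵐ t ∂(volume.restrict (Ioo 0 T)), ∫⁻ x, ‖u t x‖ₑ ^ 2 ≤ ENNReal.ofReal Cu' ^ 2 := by
    filter_upwards [hCu'] with t ht
    calc ∫⁻ x, ‖u t x‖ₑ ^ 2 ≤ ∫⁻ _ : UnitAddTorus d, ENNReal.ofReal Cu' ^ 2 := by
          refine lintegral_mono_ae ?_
          filter_upwards [ht] with x hx
          gcongr
          rw [← ofReal_norm]
          exact ENNReal.ofReal_le_ofReal hx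
      _ = ENNReal.ofReal Cu' ^ 2 := by rw [lintegral_const, measure_univ, mul_one]
  calc ∫⁻ t in Ioo 0 T, (∫⁻ x, ‖u t x‖ₑ ^ 2) ^ (1 / 2 : ℝ)
      ≤ ∫⁻ _ in Ioo 0 T, (ENNReal.ofReal Cu' ^ 2) ^ (1 / 2 : ℝ) := by
        refine lintegral_mono_ae ?_
        filter_upwards [hu2] with t ht
        exact ENNReal.rpow_le_rpow ht (by norm_num)
    _ < ⊤ := by
        rw [lintegral_const, Measure.restrict_apply_univ]
        exact ENNReal.mul_lt_top (ENNReal.rpow_lt_top_of_nonneg (by norm_num)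
          (ENNReal.pow_ne_top ENNReal.ofReal_ne_top)) measure_Ioo_lt_top

/-- **`u W ∈ L¹((0,T) × T^d)`** for a bounded drift `u ∈ L^∞((0,T) × T^d)` and a measurable field
`W ∈ L^∞(0,T; L²(T^d))` (`∫ |W(t)|² ≤ B` a.e.): `∫ ‖u(t)‖ |W(t)| ≤ C ‖W(t)‖₁ ≤ C ‖W(t)‖₂ ≤ C √B` for
a.e. `t` (Jensen on the probability space `T^d`), and `|(0,T)| < ∞`
(template: `Torus.IsWeakScalarTransportOn.of_tendsto`). [folklore] -/
theorem lintegral_mul_lt_top {T : ℝ} {u : ℝ → UnitAddTorus d → EuclideanSpace ℝ d}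
    (hu : MemLp (FunctionSpaces.Torus.stLift u) ⊤ (volume.restrict (Ioo 0 T ×ˢ univ)))
    {W : ℝ → UnitAddTorus d → ℝ}
    (hWm : AEStronglyMeasurable (FunctionSpaces.Torus.stLift W) (volume.restrict (Ioo 0 T ×ˢ univ)))
    {B : ℝ≥0} (hWb : ∀ᵐ t ∂(volume.restrict (Ioo 0 T)), ∫⁻ x, ‖W t x‖ₑ ^ 2 ≤ B) :
    ∫⁻ t in Ioo 0 T, ∫⁻ x, ‖u t x‖ₑ * ‖W t x‖ₑ < ∞ := by
  -- adapted from `Literature.Analysis.FluidPDE.Torus.IsWeakScalarTransportOn.of_tendsto`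
  obtain ⟨Cu', -, hCu'⟩ := ae_ae_norm_le_of_memLp_top_stLift hu
  have hWm' : AEStronglyMeasurable (uncurry W)
      (((volume : Measure ℝ).restrict (Ioo 0 T)).prod (volume : Measure (UnitAddTorus d))) :=
    FunctionSpaces.Torus.aestronglyMeasurable_uncurry_of_stLift_prod hWm
  have hWs : ∀ᵐ t ∂(volume.restrict (Ioo 0 T)), AEStronglyMeasurable (W t) volume :=
    hWm'.prodMk_left
  calc ∫⁻ t in Ioo 0 T, ∫⁻ x, ‖u t x‖ₑ * ‖W t x‖ₑ
      ≤ ∫⁻ _ in Ioo 0 T, ENNReal.ofReal Cu' * (B : ℝ≥0∞) ^ (1 / 2 : ℝ) := by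
        refine lintegral_mono_ae ?_
        filter_upwards [hCu', hWb, hWs] with t ht htW htm
        calc ∫⁻ x, ‖u t x‖ₑ * ‖W t x‖ₑ ≤ ∫⁻ x, ENNReal.ofReal Cu' * ‖W t x‖ₑ := by
              refine lintegral_mono_ae ?_
              filter_upwards [ht] with x hx
              gcongr
              rw [← ofReal_norm]
              exact ENNReal.ofReal_le_ofReal hx
          _ = ENNReal.ofReal Cu' * eLpNorm (W t) 1 volume := by
              rw [lintegral_const_mul' _ _ ENNReal.ofReal_ne_top, eLpNorm_one_eq_lintegral_enorm]
          _ ≤ ENNReal.ofReal Cu' * eLpNorm (W t) 2 volume := by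
              gcongr
              exact eLpNorm_le_eLpNorm_of_exponent_le one_le_two htm
          _ ≤ ENNReal.ofReal Cu' * (B : ℝ≥0∞) ^ (1 / 2 : ℝ) := by
              gcongr
              rw [FunctionSpaces.eLpNorm_two_eq_pow_two_rpow_half,
                FunctionSpaces.eLpNorm_two_pow_two_eq_lintegral]
              exact ENNReal.rpow_le_rpow htW (by norm_num)
    _ < ⊤ := by
        rw [lintegral_const, Measure.restrict_apply_univ]
        exact ENNReal.mul_lt_top (ENNReal.mul_lt_top ENNReal.ofReal_lt_top
          (ENNReal.rpow_lt_top_of_nonneg (by norm_num) ENNReal.coe_ne_top)) measure_Ioo_lt_top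

/-! ## Bookkeeping of a steady `L²` source -/

/-- **A steady `L²` source is measurable on `(0,T) × T^d`**: the space–time lift of
`(t, x) ↦ h x` is a.e. strongly measurable on `(0,T) × ℝ^d` (the uncurried field is `h ∘ snd`,
measurable for the product measure; transfer to the lift by
`FunctionSpaces.Torus.aestronglyMeasurable_stLift_of_uncurry`). [folklore] -/
theorem aestronglyMeasurable_stLift_steady {T : ℝ} {h : UnitAddTorus d → ℝ}
    (hh : AEStronglyMeasurable h volume) :
    AEStronglyMeasurable (FunctionSpaces.Torus.stLift (fun _ : ℝ => h))
      (volume.restrict (Ioo 0 T ×ˢ univ)) := by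
  refine FunctionSpaces.Torus.aestronglyMeasurable_stLift_of_uncurry (S := Ioo 0 T) ?_
  exact hh.comp_snd

/-- **A steady `L²` source is in `L¹((0,T) × T^d)`**: `∫₀ᵀ ∫ |h| = |(0,T)| · ‖h‖₁ ≤ |(0,T)| · ‖h‖₂ < ∞`
(Jensen on the probability space `T^d`). [folklore] -/
theorem lintegral_steady_source_lt_top {T : ℝ} {h : UnitAddTorus d → ℝ} (hh : MemLp h 2 volume) :
    ∫⁻ _ in Ioo 0 T, ∫⁻ x, ‖h x‖ₑ < ∞ := by
  have h1 : ∫⁻ x, ‖h x‖ₑ < ∞ := by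
    rw [← eLpNorm_one_eq_lintegral_enorm]
    exact (eLpNorm_le_eLpNorm_of_exponent_le one_le_two hh.1).trans_lt hh.eLpNorm_lt_top
  rw [lintegral_const, Measure.restrict_apply_univ]
  exact ENNReal.mul_lt_top h1 measure_Ioo_lt_top

/-! ## The stub -/

/-- **S3 `stub_forcedOfWeakIdentity`.** Let `u ∈ L^∞((0,T) × T^d)` be weakly divergence free at
a.e. time, `h ∈ L²(T^d)`, and let `W` be a space–time field with measurable lift and
`∫ |W(t)|² ≤ B` for a.e. `t ∈ (0,T)` which satisfies the sourced weak identity with the steady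
source `h` and zero datum, `∫₀ᵀ∫ W (∂ₜψ + u·∇ψ + κΔψ) = -∫₀ᵀ∫ h ψ` for every space–time test
function `ψ` on `[0,T)`. Then `W` is a weak solution of `∂ₜW + u·∇W = κΔW + h` from the zero
datum in the sense of `Torus.IsWeakScalarTransportForcedOn` (the remaining conjuncts —
`u ∈ L¹_t L²_x`, `uW ∈ L¹`, `h ∈ L¹_{t,x}` — follow from boundedness of `u`, the slice bound and
`T < ∞`; template: `IsWeakScalarTransportOn.of_tendsto`). [folklore] -/
theorem stub_forcedOfWeakIdentity {T κ : ℝ} {u : ℝ → UnitAddTorus d → EuclideanSpace ℝ d}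
    (hu : MemLp (FunctionSpaces.Torus.stLift u) ⊤ (volume.restrict (Ioo 0 T ×ˢ univ)))
    (hdiv : ∀ᵐ t ∂(volume.restrict (Ioo 0 T)), FunctionSpaces.Torus.IsWeaklyDivFree (u t))
    {h : UnitAddTorus d → ℝ} (hh : MemLp h 2 volume)
    {W : ℝ → UnitAddTorus d → ℝ}
    (hWm : AEStronglyMeasurable (FunctionSpaces.Torus.stLift W) (volume.restrict (Ioo 0 T ×ˢ univ)))
    {B : ℝ≥0} (hWb : ∀ᵐ t ∂(volume.restrict (Ioo 0 T)), ∫⁻ x, ‖W t x‖ₑ ^ 2 ≤ B)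
    (hWeq : ∀ ψ : ℝ → UnitAddTorus d → ℝ, FunctionSpaces.Torus.IsSpaceTimeTest T ψ →
      (∫ t in Ioo 0 T, ∫ x, W t x *
          (FunctionSpaces.Torus.timeDeriv ψ t x + ⟪u t x, FunctionSpaces.Torus.gradient (ψ t) x⟫_ℝ +
            κ * FunctionSpaces.Torus.laplacian (ψ t) x)) =
        -∫ t in Ioo 0 T, ∫ x, h x * ψ t x) :
    IsWeakScalarTransportForcedOn T κ u (fun _ => h) 0 W := by
  refine ⟨hWm, hu.1, aestronglyMeasurable_stLift_steady hh.1, ⟨B, hWb⟩,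
    lintegral_velocity_lt_top hu, lintegral_mul_lt_top hu hWm hWb,
    lintegral_steady_source_lt_top hh, hdiv, fun ψ hψ => ?_⟩
  have h1 := hWeq ψ hψ
  simp only [Pi.zero_apply, zero_mul, integral_zero, add_zero]
  rw [h1]
  ring

end Summit.AnomalousDissipation.AnomalousDissipation.Theorems.RelaxationBoundsInventory.ForcedOfWeakIdentity

end
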